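import Summits.CriticalPhenomena.PercolationContinuityZ3.Theorems.PercNearOneGluingNoHeavyPcintBSMXTwoSq
import HarnessLib

/-!
# PCINT lane, PHASE 6 (block renewal with reach-two pieces): one-pass coefficient checks for long horizons

Cell `prim-pcint`, seat `prim-pcint-1` (gen 15); memo `run/shared/lean/prim/pcint/T-FIBRE-ROUTE.md` §PHASE 6.

Indexing a long coefficient list entry by entry inside one kernel check is quadratic (in time and in the kernel's
reduction cache); the square checks of …PcintBSMXTwoSq are therefore repackaged as a single linear pass over the list
(`BSMX.sqAll`, a Boolean recursion; **`BSMX.sqAll_getD`** recovers the entrywise statement), giving the real-form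
coefficient hypotheses of `BSMX.G0H_le_of_chunks` for the `ℤ⁴` instance: **`BSMX.u_two_flat`**, **`BSMX.cadj_two_flat`**.
-/

noncomputable section

namespace Summit.CriticalPhenomena.PercolationContinuityZ3.Theorems.Pcint.BSMX

open Finset OSM BSM

/-- One linear pass: for the entries `x` at positions `i ≥ M` (position counter started at `i`), `DU² ≤ x² (3i+1)`. -/
def sqAll (DU M : ℕ) : ℕ → List ℕ → Bool
  | _, [] => true
  | i, x :: xs => (decide (i < M) || decide (DU ^ 2 ≤ x ^ 2 * (3 * i + 1))) && sqAll DU M (i + 1) xs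

/-- **The one-pass check, entrywise.** -/
theorem sqAll_getD {DU M : ℕ} : ∀ (i : ℕ) (l : List ℕ), sqAll DU M i l = true →
    ∀ j < l.length, M ≤ i + j → DU ^ 2 ≤ l.getD j 0 ^ 2 * (3 * (i + j) + 1)
  | i, [], _, j, hj, _ => by simp at hj
  | i, x :: xs, h, 0, _, hM => by
    rw [sqAll, Bool.and_eq_true, Bool.or_eq_true, decide_eq_true_eq, decide_eq_true_eq] at h
    rw [List.getD_cons_zero, Nat.add_zero]
    rcases h.1 with h1 | h1
    · omega
    · exact h1
  | i, x :: xs, h, j + 1, hj, hM => by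
    rw [sqAll, Bool.and_eq_true] at h
    rw [List.getD_cons_succ, show i + (j + 1) = i + 1 + j by ring]
    exact sqAll_getD (i + 1) xs h.2 j (by simpa using hj) (by omega)

/-- **The diagonal coefficients for two time axes** from the exact values below `M` (`OSM.vrow 2 M`) and the one-pass
square check beyond. -/
theorem u_two_flat {M N DU : ℕ} {U : List ℕ} (hN : N ≤ U.length)
    (h1 : ∀ i ∈ List.range M, uqv (OSM.vrow 2 M) 2 i * DU ≤ (U.getD i 0 : ℚ)) (h2 : sqAll DU M 0 U = true) :
    ∀ i < N, u 2 i * DU ≤ (U.getD i 0 : ℝ) := by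
  intro i hi
  rcases Nat.lt_or_ge i M with h | h
  · have hq := (Rat.cast_le (K := ℝ)).2 (h1 i (List.mem_range.2 h))
    push_cast at hq
    rwa [uqv_cast h.le] at hq
  · have := sqAll_getD 0 U h2 i (by omega) (by omega)
    rw [Nat.zero_add] at this
    exact u_two_le_of_sq this

/-- **The adjacent coefficients for two time axes**, same form (`cadj 2 i ≤ u 2 i` beyond the cut). -/
theorem cadj_two_flat {M N DU : ℕ} {C : List ℕ} (hN : N ≤ C.length)
    (h1 : ∀ i ∈ List.range M, cadjqv (OSM.vrow 2 (M + 1)) 2 i * DU ≤ (C.getD i 0 : ℚ)) (h2 : sqAll DU M 0 C = true) :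
    ∀ i < N, cadj 2 i * DU ≤ (C.getD i 0 : ℝ) := by
  intro i hi
  rcases Nat.lt_or_ge i M with h | h
  · have hq := (Rat.cast_le (K := ℝ)).2 (h1 i (List.mem_range.2 h))
    push_cast at hq
    rwa [cadjqv_cast (by omega)] at hq
  · have := sqAll_getD 0 C h2 i (by omega) (by omega)
    rw [Nat.zero_add] at this
    have hle := (cadj_bounds (k := 2) le_rfl i).2
    exact (mul_le_mul_of_nonneg_right hle (Nat.cast_nonneg DU)).trans (u_two_le_of_sq this)

end Summit.CriticalPhenomena.PercolationContinuityZ3.Theorems.Pcint.BSMX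

end
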